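import Mathlib.RingTheory.LocalRing.MaximalIdeal.Basic
import Mathlib.RingTheory.MvPolynomial.Homogeneous
import Mathlib.RingTheory.MvPolynomial.Ideal
import Mathlib.RingTheory.MvPolynomial.Expand
import Mathlib.RingTheory.Ideal.Maps
import Mathlib.Algebra.CharP.Two
import Mathlib.Algebra.CharP.Lemmas
import Mathlib.Algebra.CharP.Algebra
import Mathlib.Tactic.LinearCombination
import Summits.ResolutionOfSingularities.ResolutionOfSingularities.Theorems.FrobeniusClosingSteerLocalPolynomialReduction
import HarnessLib

/-!
# Steer σ-residual — the LOCAL → POLYNOMIAL reduction, ODD-degree twin of (R3) (res-type-062's hAR S2 dictionary)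

OURS (campaign res-hironaka, rung L ★L-G4, slot W4.1, crux `Steer` stmt-ResolutionOfSingularities-16345; res-L0-w41-plan-1 RULING 129b
«026 = the ODD-degree twin of R3 (z − φ h² ∈ 𝔪^d, d odd ⇒ degree-d form C_d with z − φ(h′)² − φ C_d ∈ 𝔪^(d+1))»; consumer:
res-type-062's `hAR-BLUEPRINT.md` b05763b89178e0bc §2 row S2 / §5). Pure commutative algebra, Mathlib + the sibling file
`…LocalPolynomialReduction` ((R1) `mem_pow_comap_of_map_mem_pow`, (R2) `exists_sub_map_mem_pow`), Theses-free, definition-free;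
AI-produced, weaker than expert review; nothing here is a statement of the manuscript under review.

SETTING (as in (R1)–(R3)). `φ : κ[X_0, …, X_{n−1}] →+* B` injective into a LOCAL ring `B` with `φ⁻¹ 𝔪_B = (X_0, …, X_{n−1})` and
`hfrac : ∀ z : B, ∃ a b, b ∉ φ⁻¹ 𝔪_B ∧ z * φ b = φ a` («`B` is the localisation of the polynomial ring at the origin, up to the obvious
identification»; in the application `B = S(i+1) ⧸ (u)` or the A-stage member read through a chart).
* `exists_isHomogeneous_sub_map_mem_pow_succ` — INITIAL FORM: `w ∈ 𝔪_B^d ⇒ ∃ C_d` homogeneous of degree `d` with `w − φ C_d ∈ 𝔪_B^(d+1)`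
  (any `d`, any characteristic: R2 makes `w` a polynomial modulo `𝔪_B^(d+1)`, R1 puts that polynomial in `(X)^d`, its degree-`d`
  component is `C_d`).
* `exists_isHomogeneous_sub_map_sq_sub_map_mem_pow_succ` — the same for `w = z − φ h²` (the cleaned radicand of ODD cleaned order `d`).
* `eq_of_isHomogeneous_of_sub_map_sq_mem_pow_succ_of_odd` — characteristic `2`, `d` ODD: the degree-`d` form is CLEANER-INDEPENDENT and
  unique (`z − φ h² − φ C`, `z − φ h′² − φ C′ ∈ 𝔪_B^(d+1)` ⇒ `C = C′`: the difference is `φ((h′−h)² + C′ − C)`, and a square has no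
  odd-degree component, `homogeneousComponent_sq_eq_zero_of_odd`).
* `sub_map_sq_sub_map_mem_pow_succ_of_odd` — RULING 129b's phrasing: the form `C_d` read off ONE cleaner `h` serves EVERY cleaner `h′`
  with `z − φ h′² ∈ 𝔪_B^d`.
* `exists_eq_sq_add_isHomogeneous_of_map_sub_sq_mem_pow_odd` — (R3) for odd degree `2e+1`: `deg C ≤ 2e+1`, `φ C − z² ∈ 𝔪_B^(2e+1)` ⇒
  `C = q² + C_{2e+1}` with `q` supported in degrees `≤ e` (polynomial core `exists_eq_sq_add_isHomogeneous_of_sub_sq_mem_pow_odd`, the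
  odd twin of res-L0-w41-idea-3's SQ1).
-/

noncomputable section

-- single-problem summit: the doubled namespace component `ResolutionOfSingularities` is forced
set_option linter.dupNamespace false

namespace Summit.ResolutionOfSingularities.ResolutionOfSingularities.Theorems.SwitchingDichotomy.ConstOrder

open IsLocalRing MvPolynomial

/-! ## Polynomial bookkeeping in `κ[X_0, …, X_{n−1}]` -/

section Polynomial

variable {κ : Type*} [Field κ] {n : ℕ}

/-- `g ∈ (X)^d ⇒ g − g_d ∈ (X)^(d+1)` (`g_d` = the degree-`d` homogeneous component). [folklore] -/
theorem sub_homogeneousComponent_mem_pow_succ {g : MvPolynomial (Fin n) κ} {d : ℕ}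
    (hg : g ∈ Ideal.span (Set.range (X : Fin n → MvPolynomial (Fin n) κ)) ^ d) :
    g - homogeneousComponent d g ∈ Ideal.span (Set.range (X : Fin n → MvPolynomial (Fin n) κ)) ^ (d + 1) := by
  change g ∈ idealOfVars (Fin n) κ ^ d at hg
  change g - homogeneousComponent d g ∈ idealOfVars (Fin n) κ ^ (d + 1)
  rw [mem_pow_idealOfVars_iff'] at hg ⊢
  intro x hx
  rw [coeff_sub, coeff_homogeneousComponent]
  by_cases h : x.degree = d
  · rw [if_pos h, sub_self]
  · rw [if_neg h, sub_zero]
    exact hg x (by omega)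

/-- A polynomial all of whose monomials have degree `≥ d + 1` has zero degree-`d` component. [folklore] -/
theorem homogeneousComponent_eq_zero_of_mem_pow_succ {g : MvPolynomial (Fin n) κ} {d : ℕ}
    (hg : g ∈ Ideal.span (Set.range (X : Fin n → MvPolynomial (Fin n) κ)) ^ (d + 1)) :
    homogeneousComponent d g = 0 := by
  change g ∈ idealOfVars (Fin n) κ ^ (d + 1) at hg
  rw [mem_pow_idealOfVars_iff] at hg
  refine homogeneousComponent_eq_zero' d g fun m hm h => ?_
  have := hg m hm
  omega

/-- In characteristic `2` every monomial of a SQUARE has even degree (`q² = Σ q_α² X^(2α)`). [folklore] -/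
theorem even_degree_of_mem_support_sq [CharP κ 2] (q : MvPolynomial (Fin n) κ) {m : Fin n →₀ ℕ}
    (hm : m ∈ (q ^ 2).support) : Even (m.degree) := by
  classical
  haveI : Fact (Nat.Prime 2) := ⟨Nat.prime_two⟩
  rw [← map_frobenius_expand (p := 2)] at hm
  have hm' : m ∈ (expand 2 q).support := support_map_subset _ _ hm
  rw [support_expand q two_ne_zero, Finset.mem_image] at hm'
  obtain ⟨a, -, rfl⟩ := hm'
  refine ⟨a.degree, ?_⟩
  rw [two_nsmul, map_add]

/-- In characteristic `2` a square has NO component of odd degree. [folklore] -/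
theorem homogeneousComponent_sq_eq_zero_of_odd [CharP κ 2] (q : MvPolynomial (Fin n) κ) {d : ℕ} (hd : Odd d) :
    homogeneousComponent d (q ^ 2) = 0 := by
  refine homogeneousComponent_eq_zero' d (q ^ 2) fun m hm h => ?_
  have heven := even_degree_of_mem_support_sq q hm
  rw [h] at heven
  exact (Nat.not_even_iff_odd.mpr hd) heven

/-- **(SQ1, odd degree)** (characteristic `2`): if `deg C ≤ 2e+1` and `C − h² ∈ (X)^(2e+1)`, then `C = q² + C_d` with `C_d`
homogeneous of degree `2e+1` and every monomial of `q` of degree `≤ e` (`q :=` the part of `h` of degree `≤ e`, `r := h − q ∈ (X)^(e+1)`,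
`h² = q² + r²`, `r² ∈ (X)^(2e+2) ⊆ (X)^(2e+1)`; `C − q²` has all monomials of degree `≥ 2e+1` and `≤ 2e+1`). The odd twin of
res-L0-w41-idea-3's `ConeSquare.exists_eq_sq_add_isHomogeneous_of_sub_sq_mem_pow`. [folklore] -/
theorem exists_eq_sq_add_isHomogeneous_of_sub_sq_mem_pow_odd [CharP κ 2] (e : ℕ) (C h : MvPolynomial (Fin n) κ)
    (hdeg : C.totalDegree ≤ 2 * e + 1)
    (hmem : C - h ^ 2 ∈ Ideal.span (Set.range (X : Fin n → MvPolynomial (Fin n) κ)) ^ (2 * e + 1)) :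
    ∃ q Cd : MvPolynomial (Fin n) κ,
      C = q ^ 2 + Cd ∧ Cd.IsHomogeneous (2 * e + 1) ∧ ∀ m ∈ q.support, (m.degree : ℕ) ≤ e := by
  classical
  -- `q` = the truncation of `h` at degree `≤ e`
  set q : MvPolynomial (Fin n) κ := ∑ i ∈ Finset.range (e + 1), homogeneousComponent i h with hq
  have hcoeff_q : ∀ m : Fin n →₀ ℕ, coeff m q = if (m.degree : ℕ) < e + 1 then coeff m h else 0 := by
    intro m
    rw [hq, MvPolynomial.coeff_sum]
    simp_rw [coeff_homogeneousComponent]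
    split_ifs with hm
    · rw [Finset.sum_eq_single_of_mem (m.degree : ℕ) (Finset.mem_range.mpr hm)
        (fun b _ hb => if_neg (Ne.symm hb)), if_pos rfl]
    · refine Finset.sum_eq_zero fun i hi => ?_
      rw [if_neg]
      rintro rfl
      exact hm (Finset.mem_range.mp hi)
  have hq_supp : ∀ m ∈ q.support, (m.degree : ℕ) ≤ e := by
    intro m hm
    rw [MvPolynomial.mem_support_iff, hcoeff_q] at hm
    by_contra hlt
    exact hm (if_neg (by omega))
  have hq_td : q.totalDegree ≤ e := by
    refine totalDegree_finsetSum_le fun i hi => ?_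
    have hi' : i ≤ e := by
      have := Finset.mem_range.mp hi
      omega
    exact (homogeneousComponent_isHomogeneous i h).totalDegree_le.trans hi'
  -- `r := h − q ∈ (X)^(e+1)`
  have hr : h - q ∈ idealOfVars (Fin n) κ ^ (e + 1) := by
    rw [mem_pow_idealOfVars_iff']
    intro m hm
    rw [MvPolynomial.coeff_sub, hcoeff_q, if_pos hm, sub_self]
  -- in characteristic 2: `h² = q² + (h − q)²`
  have hsq : h ^ 2 = q ^ 2 + (h - q) ^ 2 := by
    have h2 : (2 : MvPolynomial (Fin n) κ) = 0 := CharTwo.two_eq_zero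
    linear_combination (q * (h - q)) * h2
  have hr2 : (h - q) ^ 2 ∈ idealOfVars (Fin n) κ ^ (2 * e + 1) := by
    have h2 : (h - q) ^ 2 ∈ idealOfVars (Fin n) κ ^ (2 * e + 2) := by
      rw [show 2 * e + 2 = (e + 1) + (e + 1) by ring, pow_add, pow_two]
      exact Ideal.mul_mem_mul hr hr
    exact Ideal.pow_le_pow_right (by omega) h2
  have hCd : C - q ^ 2 ∈ idealOfVars (Fin n) κ ^ (2 * e + 1) := by
    have hC : C - h ^ 2 ∈ idealOfVars (Fin n) κ ^ (2 * e + 1) := hmem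
    have : C - q ^ 2 = (C - h ^ 2) + (h - q) ^ 2 := by rw [hsq]; ring
    rw [this]
    exact add_mem hC hr2
  refine ⟨q, C - q ^ 2, by ring, ?_, hq_supp⟩
  -- `C − q²` is a `(2e+1)`-form: degrees `≤ 2e+1` (degree bound) and `≥ 2e+1` (membership in `(X)^(2e+1)`)
  have hle : (C - q ^ 2).totalDegree ≤ 2 * e + 1 :=
    (totalDegree_sub C (q ^ 2)).trans (max_le hdeg ((totalDegree_pow q 2).trans (by
      calc 2 * q.totalDegree ≤ 2 * e := Nat.mul_le_mul_left 2 hq_td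
        _ ≤ 2 * e + 1 := Nat.le_succ _)))
  rw [mem_pow_idealOfVars_iff] at hCd
  have hP : C - q ^ 2 = homogeneousComponent (2 * e + 1) (C - q ^ 2) := by
    ext m
    rw [coeff_homogeneousComponent]
    split_ifs with hm
    · rfl
    · by_contra hne
      have hm' : m ∈ (C - q ^ 2).support := MvPolynomial.mem_support_iff.mpr hne
      have h1 : (∑ a ∈ m.support, m a) ≤ 2 * e + 1 := (le_totalDegree hm').trans hle
      have h2 : 2 * e + 1 ≤ ∑ a ∈ m.support, m a := (Finsupp.degree_apply m) ▸ hCd m hm'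
      exact hm ((Finsupp.degree_apply m).trans (le_antisymm h1 h2))
  rw [hP]
  exact homogeneousComponent_isHomogeneous _ _

end Polynomial

/-! ## The local versions (setting of (R1)–(R3)) -/

section Local

variable {κ B : Type*} [Field κ] [CommRing B] [IsLocalRing B] {n : ℕ} (φ : MvPolynomial (Fin n) κ →+* B)

/-- **INITIAL FORM.** In the setting of (R1)–(R3) (`φ` injective, `φ⁻¹ 𝔪_B = (X)`, every element of `B` a fraction): every
`w ∈ 𝔪_B^d` is a degree-`d` FORM modulo `𝔪_B^(d+1)`: `∃ C_d` homogeneous of degree `d` with `w − φ C_d ∈ 𝔪_B^(d+1)` (any `d`, any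
characteristic). (R2: `w ≡ φ c (mod 𝔪_B^(d+1))`; then `φ c ∈ 𝔪_B^d`, so `c ∈ (X)^d` by R1, and `C_d := c_d` with `c − c_d ∈ (X)^(d+1)`.)
[folklore] -/
theorem exists_isHomogeneous_sub_map_mem_pow_succ (hφ : Function.Injective φ)
    (h𝔭 : (maximalIdeal B).comap φ = Ideal.span (Set.range X))
    (hfrac : ∀ z : B, ∃ a b : MvPolynomial (Fin n) κ, b ∉ (maximalIdeal B).comap φ ∧ z * φ b = φ a)
    (d : ℕ) (w : B) (hw : w ∈ maximalIdeal B ^ d) :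
    ∃ Cd : MvPolynomial (Fin n) κ, Cd.IsHomogeneous d ∧ w - φ Cd ∈ maximalIdeal B ^ (d + 1) := by
  have h𝔭max : ((maximalIdeal B).comap φ).IsMaximal := by
    rw [h𝔭]
    exact isMaximal_span_range_X
  obtain ⟨a, b, hb, hab⟩ := hfrac w
  obtain ⟨c, hc⟩ := exists_sub_map_mem_pow φ h𝔭max w a b hb hab (d + 1)
  -- `φ c ∈ 𝔪_B^d`, hence `c ∈ (X)^d`
  have hφc : φ c ∈ maximalIdeal B ^ d := by
    have : φ c = w - (w - φ c) := by ring
    rw [this]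
    exact sub_mem hw (Ideal.pow_le_pow_right (Nat.le_succ d) hc)
  have hcX : c ∈ Ideal.span (Set.range (X : Fin n → MvPolynomial (Fin n) κ)) ^ d := by
    rw [← h𝔭]
    exact mem_pow_comap_of_map_mem_pow φ hφ h𝔭max hfrac d c hφc
  refine ⟨homogeneousComponent d c, homogeneousComponent_isHomogeneous d c, ?_⟩
  -- `c − c_d ∈ (X)^(d+1) = (φ⁻¹ 𝔪_B)^(d+1)`, so `φ (c − c_d) ∈ 𝔪_B^(d+1)`
  have htail : c - homogeneousComponent d c ∈ ((maximalIdeal B).comap φ) ^ (d + 1) := by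
    rw [h𝔭]
    exact sub_homogeneousComponent_mem_pow_succ hcX
  have hφtail : φ (c - homogeneousComponent d c) ∈ maximalIdeal B ^ (d + 1) := by
    have := Ideal.le_comap_pow φ (d + 1) htail
    rwa [Ideal.mem_comap] at this
  have hre : w - φ (homogeneousComponent d c) = (w - φ c) + φ (c - homogeneousComponent d c) := by
    rw [map_sub]
    ring
  rw [hre]
  exact add_mem hc hφtail

/-- **INITIAL FORM of a cleaned radicand.** Same setting: if `z − φ h² ∈ 𝔪_B^d` (a radicand `z` cleaned by the «polynomial» cleaner
`φ h` to order `≥ d`), then `z − φ h² − φ C_d ∈ 𝔪_B^(d+1)` for some degree-`d` form `C_d` (any `d`, any characteristic). [folklore] -/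
theorem exists_isHomogeneous_sub_map_sq_sub_map_mem_pow_succ (hφ : Function.Injective φ)
    (h𝔭 : (maximalIdeal B).comap φ = Ideal.span (Set.range X))
    (hfrac : ∀ z : B, ∃ a b : MvPolynomial (Fin n) κ, b ∉ (maximalIdeal B).comap φ ∧ z * φ b = φ a)
    (d : ℕ) (z : B) (h : MvPolynomial (Fin n) κ) (hz : z - φ (h ^ 2) ∈ maximalIdeal B ^ d) :
    ∃ Cd : MvPolynomial (Fin n) κ, Cd.IsHomogeneous d ∧ z - φ (h ^ 2) - φ Cd ∈ maximalIdeal B ^ (d + 1) :=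
  exists_isHomogeneous_sub_map_mem_pow_succ φ hφ h𝔭 hfrac d (z - φ (h ^ 2)) hz

/-- **UNIQUENESS of the odd initial form** (characteristic `2`, `d` ODD): if `z − φ h² − φ C ∈ 𝔪_B^(d+1)` and
`z − φ h′² − φ C′ ∈ 𝔪_B^(d+1)` with `C`, `C′` forms of degree `d`, then `C = C′` — whatever the cleaners `h`, `h′`. (The difference is
`φ ((h′ − h)² + (C′ − C)) ∈ 𝔪_B^(d+1)`; R1 puts `(h′ − h)² + (C′ − C)` in `(X)^(d+1)`, so its degree-`d` component `0 + (C′ − C)`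
vanishes: a square has only even-degree monomials in characteristic `2`.) [folklore] -/
theorem eq_of_isHomogeneous_of_sub_map_sq_mem_pow_succ_of_odd [CharP B 2] (hφ : Function.Injective φ)
    (h𝔭 : (maximalIdeal B).comap φ = Ideal.span (Set.range X))
    (hfrac : ∀ z : B, ∃ a b : MvPolynomial (Fin n) κ, b ∉ (maximalIdeal B).comap φ ∧ z * φ b = φ a)
    {d : ℕ} (hd : Odd d) (z : B) (h h' C C' : MvPolynomial (Fin n) κ) (hC : C.IsHomogeneous d)
    (hC' : C'.IsHomogeneous d) (h₁ : z - φ (h ^ 2) - φ C ∈ maximalIdeal B ^ (d + 1))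
    (h₂ : z - φ (h' ^ 2) - φ C' ∈ maximalIdeal B ^ (d + 1)) : C = C' := by
  haveI : Fact (Nat.Prime 2) := ⟨Nat.prime_two⟩
  -- `κ` has characteristic `2` too (`κ → κ[X] → B` is injective)
  haveI : CharP κ 2 :=
    (φ.comp (MvPolynomial.C : κ →+* MvPolynomial (Fin n) κ)).charP (hφ.comp (MvPolynomial.C_injective (Fin n) κ)) 2
  have h𝔭max : ((maximalIdeal B).comap φ).IsMaximal := by
    rw [h𝔭]
    exact isMaximal_span_range_X
  -- the difference of the two congruences
  set D : MvPolynomial (Fin n) κ := (h' - h) ^ 2 + (C' - C) with hD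
  have hsq : (h' - h) ^ 2 = h' ^ 2 - h ^ 2 - 2 * (h * (h' - h)) := by ring
  have hD' : D = h' ^ 2 - h ^ 2 + (C' - C) := by
    rw [hD, hsq, (CharTwo.two_eq_zero : (2 : MvPolynomial (Fin n) κ) = 0)]
    ring
  have hφD : φ D ∈ maximalIdeal B ^ (d + 1) := by
    have hre : φ D = (z - φ (h ^ 2) - φ C) - (z - φ (h' ^ 2) - φ C') := by
      rw [hD', map_add, map_sub, map_sub, map_pow, map_pow]
      ring
    rw [hre]
    exact sub_mem h₁ h₂
  have hDX : D ∈ Ideal.span (Set.range (X : Fin n → MvPolynomial (Fin n) κ)) ^ (d + 1) := by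
    rw [← h𝔭]
    exact mem_pow_comap_of_map_mem_pow φ hφ h𝔭max hfrac (d + 1) D hφD
  have hcomp : homogeneousComponent d D = C' - C := by
    rw [hD, map_add, homogeneousComponent_sq_eq_zero_of_odd (h' - h) hd, zero_add,
      homogeneousComponent_of_mem (hC'.sub hC), if_pos rfl]
  have hzero : homogeneousComponent d D = 0 := homogeneousComponent_eq_zero_of_mem_pow_succ hDX
  rw [hcomp, sub_eq_zero] at hzero
  exact hzero.symm

/-- **CLEANER-INDEPENDENCE of the odd initial form** (RULING 129b's phrasing; characteristic `2`, `d` ODD): the degree-`d` form `C`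
read off ONE cleaner (`z − φ h² − φ C ∈ 𝔪_B^(d+1)`) serves EVERY cleaner `h′` of order `≥ d` (`z − φ h′² ∈ 𝔪_B^d`):
`z − φ h′² − φ C ∈ 𝔪_B^(d+1)`. [folklore] -/
theorem sub_map_sq_sub_map_mem_pow_succ_of_odd [CharP B 2] (hφ : Function.Injective φ)
    (h𝔭 : (maximalIdeal B).comap φ = Ideal.span (Set.range X))
    (hfrac : ∀ z : B, ∃ a b : MvPolynomial (Fin n) κ, b ∉ (maximalIdeal B).comap φ ∧ z * φ b = φ a)
    {d : ℕ} (hd : Odd d) (z : B) (h h' C : MvPolynomial (Fin n) κ) (hC : C.IsHomogeneous d)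
    (h₁ : z - φ (h ^ 2) - φ C ∈ maximalIdeal B ^ (d + 1)) (h₂ : z - φ (h' ^ 2) ∈ maximalIdeal B ^ d) :
    z - φ (h' ^ 2) - φ C ∈ maximalIdeal B ^ (d + 1) := by
  obtain ⟨C', hC', h₂'⟩ := exists_isHomogeneous_sub_map_sq_sub_map_mem_pow_succ φ hφ h𝔭 hfrac d z h' h₂
  have hCC' : C = C' :=
    eq_of_isHomogeneous_of_sub_map_sq_mem_pow_succ_of_odd φ hφ h𝔭 hfrac hd z h h' C C' hC hC' h₁ h₂'
  rw [hCC']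
  exact h₂'

/-- **(R3, odd degree)**: `φ : κ[X_0, …, X_{n−1}] → B` injective into a local ring of characteristic `2` with `φ⁻¹ 𝔪_B = (X)` and every
element of `B` a fraction; if `deg C ≤ 2e+1` and `φ C − z² ∈ 𝔪_B^(2e+1)` for some `z ∈ B`, then `C = q² + C_{2e+1}` with `C_{2e+1}` a
`(2e+1)`-form and `q` supported in degrees `≤ e`. (R2 replaces `z` by a polynomial `φ h` modulo `𝔪_B^(e+1)`; in characteristic `2`
`(z − φ h)² = z² − φ h² ∈ 𝔪_B^(2e+2)`, so `φ (C − h²) ∈ 𝔪_B^(2e+1)`; R1 contracts; the odd SQ1 splits.) [folklore] -/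
theorem exists_eq_sq_add_isHomogeneous_of_map_sub_sq_mem_pow_odd [CharP B 2] (hφ : Function.Injective φ)
    (h𝔭 : (maximalIdeal B).comap φ = Ideal.span (Set.range X))
    (hfrac : ∀ z : B, ∃ a b : MvPolynomial (Fin n) κ, b ∉ (maximalIdeal B).comap φ ∧ z * φ b = φ a)
    (e : ℕ) (C : MvPolynomial (Fin n) κ) (hdeg : C.totalDegree ≤ 2 * e + 1) (z : B)
    (hC : φ C - z ^ 2 ∈ maximalIdeal B ^ (2 * e + 1)) :
    ∃ q Cd : MvPolynomial (Fin n) κ, C = q ^ 2 + Cd ∧ Cd.IsHomogeneous (2 * e + 1) ∧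
      ∀ m ∈ q.support, (m.degree : ℕ) ≤ e := by
  haveI : Fact (Nat.Prime 2) := ⟨Nat.prime_two⟩
  haveI : CharP κ 2 :=
    (φ.comp (MvPolynomial.C : κ →+* MvPolynomial (Fin n) κ)).charP (hφ.comp (MvPolynomial.C_injective (Fin n) κ)) 2
  have h𝔭max : ((maximalIdeal B).comap φ).IsMaximal := by
    rw [h𝔭]
    exact isMaximal_span_range_X
  obtain ⟨a, b, hb, hz⟩ := hfrac z
  obtain ⟨h, hh⟩ := exists_sub_map_mem_pow φ h𝔭max z a b hb hz (e + 1)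
  -- `φ (C − h²) = (φ C − z²) + (z − φ h)²` in characteristic `2`
  have hsq : (z - φ h) ^ 2 = z ^ 2 - φ h ^ 2 := sub_pow_char z (φ h)
  have hmem : φ (C - h ^ 2) ∈ maximalIdeal B ^ (2 * e + 1) := by
    have hre : φ (C - h ^ 2) = (φ C - z ^ 2) + (z - φ h) ^ 2 := by
      rw [map_sub, map_pow, hsq]
      ring
    rw [hre]
    refine add_mem hC ?_
    have h2 := Ideal.pow_mem_pow hh 2
    rw [← pow_mul] at h2
    exact Ideal.pow_le_pow_right (by omega) h2
  have hpoly : C - h ^ 2 ∈ Ideal.span (Set.range (X : Fin n → MvPolynomial (Fin n) κ)) ^ (2 * e + 1) := by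
    rw [← h𝔭]
    exact mem_pow_comap_of_map_mem_pow φ hφ h𝔭max hfrac (2 * e + 1) (C - h ^ 2) hmem
  exact exists_eq_sq_add_isHomogeneous_of_sub_sq_mem_pow_odd e C h hdeg hpoly

end Local

end Summit.ResolutionOfSingularities.ResolutionOfSingularities.Theorems.SwitchingDichotomy.ConstOrder

end
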